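import Summits.BirchSwinnertonDyer.BirchSwinnertonDyer.Theorems.GenusKolyvaginAtTwoGenusDeepSupplyAtTwoNegDiscNarrowOfK1OfWallU2
import HarnessLib

/-!
# Route `GenusKolyvaginAtTwo`, crux 23491 `GenusDeepSupplyAtTwoNegDiscNarrow` BY NAME ⟸ WALL row 1 + U₂ + Q2 + PRINT + the five supply items —
# with NEITHER kernel: K₁ (`K1Neg`) is WALL + U₂ + PRINT, and K₄⁻ (`K4Neg`) is never needed (LEAD g29, p791748)

LEAD seat `bsd-line-gk2-p1` g29, `--supports stmt-BirchSwinnertonDyer-23491 --as helper`.  THEOREMS ONLY; no `sorry`; standard axioms.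
**BSD is NOT proved here; crux 23491 is NOT closed (every hypothesis below is an OPEN route item or a PRINT item, BY NAME); K1Neg / K4Neg are NOT
proved unconditionally.**  CENSUS READING (director (644)(a)/(657), inter-route): modulo the PRINT items and the five supply items GZ/Mod/Par/Conv/Conv′,
the Δ<0 supply crux 23491 — and with it the whole K-itemisation K₁/K₄⁻/glue (31525/31526/31527) — is implied by WALL row 1 (the four
`ByReductionTypeAtTwo` rows 19095–19098) ∧ U₂ (`MinimalTwinBSDTwo` 22985) ∧ Q2 (`KolyvaginRelationAtTwo` 24880).

* §1 `k1Neg_of_wallRows_U2` — **K1Neg ⟸ WALL rows + U₂ + GZ + GZK + L + Milne**: the pair ledger (`Lossless.natCard_primaryComponent_sha_baseChange_two_eq_pow_of_bsdp_pair`,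
  `#Ш(E/K)[2^∞] = 4^(M₀)` from `BSD₂(E)` + `BSD₂(Wd)`) against `#Ш(E/K)[2^∞] = 1` on the `#Sel₂(E) = 1` cell
  (`Lossless.natCard_primaryComponent_sha_baseChange_two_eq_one_of_natCard_selmerGroup_eq_one`) forces `M₀ = 0` — the proof of gk2-p5's
  `Lossless.K1_of_nonCMAtTwo` with the leaf replaced by the two BSD₂ inputs it actually uses.
* §2 ★★★ `genusDeepSupplyAtTwoNegDiscNarrow_of_wallRows_U2` — **crux 23491 BY NAME ⟸ GZ ∧ Mod ∧ Par ∧ Conv ∧ Conv′ ∧ the four WALL rows ∧ U₂ ∧ Q2 ∧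
  GZK ∧ L ∧ Milne** (thirteen displayed hypotheses; no K-item): §1 fed into `genusDeepSupplyAtTwoNegDiscNarrow_of_K1Neg_of_wallRows_U2`.

References: [GrossZagier1986] Thm. I.6.3, V.§2 (2.2); [Kramer1981] Thm. 1; [Milne1972ArithmeticAV] §1 Thm. 1; [McCallumLMS1991] §5;
[MazurRubin2010] Cor. 3.4 (i); [LawsonWuthrich2016] §3, §7.1.
-/

set_option autoImplicit false
set_option linter.dupNamespace false -- `Summit.<P>.<Sub>` repeats `BirchSwinnertonDyer` (D-0017)

noncomputable section

open scoped Classical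

namespace Summit.BirchSwinnertonDyer.BirchSwinnertonDyer.Theorems.GenusSupplyNarrow.PrimeFrame

open WeierstrassCurve NumberField IsDedekindDomain Field
  Literature.NumberTheory.EllipticCurves Literature.NumberTheory.EllipticCurves.ModularForms
  Literature.NumberTheory.GaloisRepresentations
  Summit.BirchSwinnertonDyer.BirchSwinnertonDyer.Theses.GenusKolyvaginAtTwo
  Summit.BirchSwinnertonDyer.BirchSwinnertonDyer.Theorems.GenusKoly
  Summit.BirchSwinnertonDyer.BirchSwinnertonDyer.Theorems.GenusSupplyNarrow
open Summit.BirchSwinnertonDyer.BirchSwinnertonDyer.Theses.ByReductionTypeAtTwo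
  (GoodOrdinaryRankZeroAtTwo MultiplicativeRankZeroAtTwo SupersingularRankZeroAtTwo AdditiveRankZeroAtTwo)
open Summit.BirchSwinnertonDyer.BirchSwinnertonDyer.Theorems.GenusExact

/-! ## §1 K₁ from WALL + U₂ + PRINT -/

/-- **K1Neg ⟸ WALL row 1 + U₂ + PRINT.**  On the `#Sel₂(E) = 1` cell of a Δ<0 frame with a `Sel₂`-minimal twin of analytic rank `1` and genus
budget `≤ 1` bit, `BSD₂(E)` (the four WALL rows by name, `Census.bsdp_rankZero_of_wallRows`) and `BSD₂(Wd)` (U₂ by name; the twin is non-CM)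
give `#Ш(E/K)[2^∞] = 4^(M₀)` (pair ledger), while the Selmer count gives `#Ш(E/K)[2^∞] = 1`; so `1 ≤ M₀` is absurd.  CONDITIONAL on OPEN route
items; BSD is NOT proved; K1Neg is NOT proved unconditionally. [cite: GrossZagier1986, V.§2 (2.2)] [cite: Kramer1981, Thm. 1]
[cite: Milne1972ArithmeticAV, §1 Thm. 1] [cite: McCallumLMS1991, §5 Lemma 5.1] -/
theorem k1Neg_of_wallRows_U2 (hOrd : GoodOrdinaryRankZeroAtTwo) (hMult : MultiplicativeRankZeroAtTwo) (hSS : SupersingularRankZeroAtTwo)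
    (hAdd : AdditiveRankZeroAtTwo) (hTw : MinimalTwinBSDTwo) (hGZ : GrossZagierAllLevels) (hGZK : MultPublishedInputsAtTwo)
    (hL : EntireLFunctionRat) (hMi : MilneAnyModel) : K1Neg := by
  intro W _ _ _ hcm hr0 hρ hT hneg h1 K _ _ hIQ hodd h3 hHe _hsq1 _hsq2 Dt _hoptDt hc β ι d₁ hy M₀ hdiv hndiv hM Wd _ _ hWd hrd hSel hDEF
  have hs2 : W.HasSurjectiveModNGaloisRep 2 := by simpa using hρ 1 one_pos
  have hBW : BSDp W 2 := Census.bsdp_rankZero_of_wallRows hOrd hMult hSS hAdd W hcm hr0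
  have hd : (NumberField.discr K : ℚ) ≠ 0 := by exact_mod_cast NumberField.discr_ne_zero K
  have hcmd : ¬ Wd.HasCM := twin_not_hasCM W hcm hd Wd hWd
  have hBd : BSDp Wd 2 := hTw Wd hcmd hrd hSel
  have hpow := Lossless.natCard_primaryComponent_sha_baseChange_two_eq_pow_of_bsdp_pair hGZ hL hGZK hMi W hs2 hT hr0 K hIQ hodd h3 hHe Dt hc β ι
    d₁ M₀ hdiv hndiv Wd hWd hrd hBW hBd
  have hone := Lossless.natCard_primaryComponent_sha_baseChange_two_eq_one_of_natCard_selmerGroup_eq_one W K hT hr0 h1 hIQ hodd hHe hs2 Dt β ι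
    d₁ hy M₀ hndiv Wd hWd hSel (Or.inl ⟨hneg, hDEF⟩)
  rw [hone] at hpow
  have h0 : 2 * M₀ = 0 := by
    rcases (Nat.pow_eq_one.mp hpow.symm) with h | h
    · exact absurd h (by norm_num)
    · exact h
  omega

/-! ## §2 The crux 23491 by name from WALL + U₂ + Q2 + PRINT + the five supply items -/

/-- ★★★ **THE Δ<0 SUPPLY CRUX `GenusDeepSupplyAtTwoNegDiscNarrow` (stmt-23491) BY NAME ⟸ GZ ∧ Mod ∧ Par ∧ Conv ∧ Conv′ ∧ the four WALL rows ∧ U₂ ∧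
Q2 ∧ GZK ∧ L ∧ Milne — no K₁, no K₄⁻.**  §1 + `genusDeepSupplyAtTwoNegDiscNarrow_of_K1Neg_of_wallRows_U2` (p791748).  CONDITIONAL on the
thirteen displayed hypotheses (OPEN route items and PRINT items, by name); BSD is NOT proved; the crux is NOT closed by this.
[cite: GrossZagier1986, Thm. I.6.3] [cite: MazurRubin2010, Prop. 3.3, Cor. 3.4 (i)] [cite: LawsonWuthrich2016, §3, §7.1]
[cite: McCallumLMS1991, §5 Thm. 5.4] -/
theorem genusDeepSupplyAtTwoNegDiscNarrow_of_wallRows_U2 (hGZ : GrossZagierAllLevels) (hmod : ModularityExistsNewform)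
    (hpar : TwoParityDD) (hconv : RankOneTwoConverse) (hconv' : RankOneTwoConverseOffSemistableAtTwo)
    (hOrd : GoodOrdinaryRankZeroAtTwo) (hMult : MultiplicativeRankZeroAtTwo) (hSS : SupersingularRankZeroAtTwo) (hAdd : AdditiveRankZeroAtTwo)
    (hTw : MinimalTwinBSDTwo) (hQ2 : KolyvaginRelationAtTwo) (hGZK : MultPublishedInputsAtTwo) (hL : EntireLFunctionRat) (hMi : MilneAnyModel) :
    GenusDeepSupplyAtTwoNegDiscNarrow :=
  genusDeepSupplyAtTwoNegDiscNarrow_of_K1Neg_of_wallRows_U2 hGZ hmod hpar hconv hconv'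
    (k1Neg_of_wallRows_U2 hOrd hMult hSS hAdd hTw hGZ hGZK hL hMi) hOrd hMult hSS hAdd hTw hQ2 hGZK hL hMi

end Summit.BirchSwinnertonDyer.BirchSwinnertonDyer.Theorems.GenusSupplyNarrow.PrimeFrame

end
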